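import Summits.CriticalPhenomena.PercolationContinuityZ3.Theorems.PercNearOneGluingNoHeavyConstsClusterSquareNDCPos
import HarnessLib

/-!
# CSQ, DUU and TS when one of the terminals is thinly attached

builds on p205010 (kernel theorem, internal audit signed; external expert review pending)

PAPER-2 track "percolation constants", part (ii), seat `prim-consts-1`, gen 17 (lane index
`run/shared/lean/prim/consts/CONSTANTS.md`, row A19; memo `FROM-prim-consts-1-g17-THREE-COPY-STRUCTURE.md` §2).
Support file for the crux `NoHeavyLowerTail` (stmt-CriticalPhenomena-4575; `--supports`).  Theorems only; no sorries.

`…ConstsClusterSquareNDCPos.lean` proves the cluster-square inequality CSQ at `(a; b, c)` (hence DUU and TS) for every finite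
weighted graph in which no *double clash* occurs among configurations of positive pairs.  A double clash consists of a `b`-clash — a
vertex `y` adjacent by a positive pair to the cluster `K = C_a(ω)`, joined to `b` in `ω` and to `c` in `η' = η ∖ (pairs meeting K)` —
together with a `c`-clash (the same with `b` and `c` exchanged).  Here we exclude `b`-clashes combinatorially whenever **`a` or `b` is
thinly attached**: a terminal `t` is thinly attached if every vertex outside `{a, b, c}` that can be reached from `t` through vertices
outside `{a, b, c}` has at most two neighbours (in a graph `H` carrying all pairs of positive weight).  Indeed the `ω`-path from `y` to
`b` avoids `K ∪ {c}`, so all its vertices but `b` are such vertices (seen from `b` along the path, or from `a` through `K` and the pair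
joining `K` to `y`); the `η'`-path from `y` to `c` avoids `K ∪ {b}` and leaves `y` through its unique neighbour outside `K`, and it can
never leave the first path, whose inner vertices have only their two path-neighbours — so it cannot reach `c` (`Consts.not_clash_of_thin`).
Consequently CSQ and DUU hold at `(a; b, c)`, and TS holds for `{a, b, c}`, as soon as one of `a, b, c` is thinly attached
(`Consts.clusterSquare_le_sq_of_thin`, `Consts.sq_real_split_le_of_thin`, `Consts.tripleSplit_of_thin`); in particular whenever every
vertex outside `{a, b, c}` has at most two neighbours — three terminals joined by internally disjoint paths in any number and pattern
(`Consts.tripleSplit_of_degree_le_two`).  Thin attachment of `t` means: `t` is joined to the rest of the graph only by internally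
disjoint paths ending at terminals, and pendant paths; the rest of the graph is arbitrary.
Reference: N. Gladkov, arXiv:2408.08457v2 (2024), Thm. 4.3, Def. 4.2, Lemma 3.1, Example 2.5, Thm. 5.2.
-/

noncomputable section

open Classical

namespace Summit.CriticalPhenomena.PercolationContinuityZ3.Theorems

open MeasureTheory Finset Literature.Probability.LatticeModels Literature.Probability.Percolation
open Literature.Probability.Percolation.DecisionTree Literature.Probability.Percolation.BHK2006
open Literature.Probability.Percolation.TargetExploration Literature.Probability.Percolation.ClusterConditioning

namespace Consts

section General

variable {V : Type*} [Fintype V]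

omit [Fintype V] in
/-- A set `B` closed under `H`-steps into vertices outside `{a, b, c}` contains the endpoint of every open walk which starts in `B`
and all of whose vertices lie in `B` or outside `{a, b, c}`. [folklore] -/
theorem mem_of_openWalk (H : SimpleGraph V) {a b c : V} {ω : Set (Sym2 V)} (B : Set V)
    (hB : ∀ u v, u ∈ B → H.Adj u v → v ≠ a → v ≠ b → v ≠ c → v ∈ B) (hωH : ∀ u v, (openGraph ω).Adj u v → H.Adj u v)
    {u v : V} (W : (openGraph ω).Walk u v) (hu : u ∈ B) (hW : ∀ x ∈ W.support, x ∈ B ∨ (x ≠ a ∧ x ≠ b ∧ x ≠ c)) :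
    v ∈ B := by
  induction W with
  | nil => exact hu
  | @cons u x v h W ih =>
    have hx : x ∈ B := by
      rcases hW x (by simp) with hx | ⟨hxa, hxb, hxc⟩
      · exact hx
      · exact hB u x hu (hωH u x h) hxa hxb hxc
    exact ih hx fun z hz => hW z (by simp [hz])

/-- **No `b`-clash when `a` or `b` is thinly attached.**  Let `H` be a graph, `B` a set of vertices closed under `H`-steps into
vertices outside `{a, b, c}`, all of whose vertices outside `{a, b, c}` have degree at most two; let `ω` be a configuration of
`H`-edges and `θ` a configuration of `H`-edges none of which meets the `ω`-cluster `K` of `a`.  If `a ↮ b` and `b ↮ c` in `ω` and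
`b ↮ c` in `θ`, then no vertex `y` with an `H`-neighbour in `K` and such that `b ∈ B` or `y ∈ B` is joined to `b` in `ω` and to `c`
in `θ`. [folklore; the combinatorial input for Gladkov2024, Thm. 4.3 / Example 2.5 on these graphs] -/
theorem not_clash_of_thin (H : SimpleGraph V) [DecidableRel H.Adj] {a b c k y : V} {ω θ : Set (Sym2 V)} (B : Set V)
    (hstart : b ∈ B ∨ y ∈ B) (hB : ∀ u v, u ∈ B → H.Adj u v → v ≠ a → v ≠ b → v ≠ c → v ∈ B)
    (hdeg : ∀ v ∈ B, v ≠ a → v ≠ b → v ≠ c → H.degree v ≤ 2)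
    (hωH : ∀ u v, (openGraph ω).Adj u v → H.Adj u v) (hθH : ∀ u v, (openGraph θ).Adj u v → H.Adj u v)
    (hθK : ∀ u v, (openGraph θ).Adj u v → ¬ (openGraph ω).Reachable a v)
    (hab : ¬ (openGraph ω).Reachable a b) (hbc : ¬ (openGraph ω).Reachable b c) (hbc' : ¬ (openGraph θ).Reachable b c)
    (hk : (openGraph ω).Reachable a k) (hky : H.Adj k y) (hby : (openGraph ω).Reachable b y)
    (hcy : (openGraph θ).Reachable c y) : False := by
  obtain ⟨P₀⟩ := hby.symm
  obtain ⟨Q⟩ := hcy.symm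
  set P := P₀.bypass with hPdef
  have hP : P.IsPath := P₀.bypass_isPath
  -- the vertices of `P` other than its endpoint `b`
  set S : Set V := {v | ∃ i, i < P.length ∧ P.getVert i = v} with hSdef
  have hreachP : ∀ i, (openGraph ω).Reachable y (P.getVert i) := fun i => ⟨P.takeUntil _ (P.getVert_mem_support i)⟩
  have hyb : y ≠ b := by rintro rfl; exact hbc' hcy.symm
  have hlen : 0 < P.length := by
    by_contra h0
    have h0' : P.length = 0 := by omega
    have := P.getVert_length
    rw [h0', P.getVert_zero] at this
    exact hyb this
  have hyS : y ∈ S := ⟨0, hlen, P.getVert_zero⟩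
  have hcS : c ∉ S := by
    rintro ⟨i, -, hi⟩
    exact hbc (hby.trans (hi ▸ hreachP i))
  have hPi_notK : ∀ j, ¬ (openGraph ω).Reachable a (P.getVert j) := fun j h =>
    hab (h.trans ((hreachP j).symm.trans hby.symm))
  have hPi_ne_b : ∀ j, j < P.length → P.getVert j ≠ b := by
    intro j hj h
    have := hP.getVert_injOn (by simp only [Set.mem_setOf_eq]; omega) (by simp only [Set.mem_setOf_eq]; exact le_rfl)
      (h.trans P.getVert_length.symm)
    omega
  -- every vertex of `P` before `b` lies in `B` (walk back from `b ∈ B`, or forward from `y ∈ B`)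
  have hPB : ∀ j, j < P.length → P.getVert j ∈ B := by
    rcases hstart with hbB | hyB
    · have hback : ∀ j, j ≤ P.length → P.getVert (P.length - j) ∈ B := by
        intro j hj
        induction j with
        | zero => rw [Nat.sub_zero, P.getVert_length]; exact hbB
        | succ j ih =>
          have hlt : P.length - (j + 1) < P.length := by omega
          have hadj := hωH _ _ (P.adj_getVert_succ hlt)
          rw [show P.length - (j + 1) + 1 = P.length - j from by omega] at hadj
          exact hB _ _ (ih (by omega)) hadj.symm (fun h => hPi_notK (P.length - (j + 1)) (by rw [h]))
            (hPi_ne_b _ hlt) (fun h => hcS ⟨_, hlt, h⟩)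
      intro j hj
      have := hback (P.length - j) (by omega)
      rwa [show P.length - (P.length - j) = j from by omega] at this
    · intro j hj
      induction j with
      | zero => rw [P.getVert_zero]; exact hyB
      | succ j ih =>
        exact hB _ _ (ih (by omega)) (hωH _ _ (P.adj_getVert_succ (show j < P.length by omega)))
          (fun h => hPi_notK (j + 1) (by rw [h])) (hPi_ne_b _ hj) (fun h => hcS ⟨_, hj, h⟩)
  obtain ⟨d, hd, hdS, hdS'⟩ := Q.exists_boundary_dart S hyS hcS
  obtain ⟨i, hi, hiv⟩ := hdS
  -- `d.snd` is joined to `y` in `θ`, hence is neither `b` nor in `K`, and it is an `H`-neighbour of `d.fst = P i`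
  have hsnd_reach : (openGraph θ).Reachable y d.snd := ⟨Q.takeUntil _ (Q.dart_snd_mem_support_of_mem_darts hd)⟩
  have hsnd_ne_b : d.snd ≠ b := by
    intro h; rw [h] at hsnd_reach; exact hbc' (hsnd_reach.symm.trans hcy.symm)
  have hsnd_K : ¬ (openGraph ω).Reachable a d.snd := hθK _ _ d.adj
  have hadj_snd : H.Adj (P.getVert i) d.snd := hiv ▸ hθH _ _ d.adj
  -- the successor of `P i` on `P`
  have hadj_succ : H.Adj (P.getVert i) (P.getVert (i + 1)) := hωH _ _ (P.adj_getVert_succ hi)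
  have hsucc_ne_snd : P.getVert (i + 1) ≠ d.snd := by
    intro h
    by_cases hi1 : i + 1 < P.length
    · exact hdS' ⟨i + 1, hi1, h⟩
    · have hi1' : i + 1 = P.length := by omega
      rw [hi1', P.getVert_length] at h
      exact hsnd_ne_b h.symm
  -- the predecessor of `P i`: `k` if `i = 0`, else `P (i - 1)`
  obtain ⟨u, hadj_pred, hpred_ne_snd, hpred_ne_succ⟩ :
      ∃ u, H.Adj (P.getVert i) u ∧ u ≠ d.snd ∧ u ≠ P.getVert (i + 1) := by
    by_cases hi0 : i = 0
    · subst hi0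
      refine ⟨k, by rw [P.getVert_zero]; exact hky.symm, fun h => hsnd_K (h ▸ hk), fun h => hPi_notK 1 (h ▸ hk)⟩
    · refine ⟨P.getVert (i - 1), ?_, fun h => hdS' ⟨i - 1, by omega, h⟩, fun h => ?_⟩
      · have h := hωH _ _ (P.adj_getVert_succ (show i - 1 < P.length by omega))
        rw [show i - 1 + 1 = i from by omega] at h
        exact h.symm
      · have := hP.getVert_injOn (by simp only [Set.mem_setOf_eq]; omega) (by simp only [Set.mem_setOf_eq]; omega) h
        omega
  -- `P i ∈ B` is not a terminal, so it has degree ≤ 2; but it has the three distinct neighbours `u`, `P (i+1)`, `d.snd`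
  have hva : P.getVert i ≠ a := fun h => hPi_notK i (by rw [h])
  have hvc : P.getVert i ≠ c := fun h => hcS ⟨i, hi, h⟩
  have hvB : P.getVert i ∈ B := hPB i hi
  have h3 : ({u, P.getVert (i + 1), d.snd} : Finset V) ⊆ H.neighborFinset (P.getVert i) := by
    intro x hx
    simp only [Finset.mem_insert, Finset.mem_singleton] at hx
    rw [SimpleGraph.mem_neighborFinset]
    rcases hx with rfl | rfl | rfl
    exacts [hadj_pred, hadj_succ, hadj_snd]
  have hcard : ({u, P.getVert (i + 1), d.snd} : Finset V).card = 3 := by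
    rw [Finset.card_eq_three]
    exact ⟨u, P.getVert (i + 1), d.snd, hpred_ne_succ, hpred_ne_snd, hsucc_ne_snd, rfl⟩
  have := (Finset.card_le_card h3).trans (SimpleGraph.card_neighborFinset_eq_degree (G := H) (v := P.getVert i) ▸
    hdeg _ hvB hva (hPi_ne_b i hi) hvc)
  omega

/-- The no-double-clash hypothesis of `Consts.clusterSquare_le_sq_of_noDoubleClash_pos` (general vertex type, for one pair
`ω, η` of configurations of `H`-edges) **holds when `a`, `b` or `c` is thinly attached**. [folklore; input for Gladkov2024, Thm. 4.3] -/
theorem not_doubleClash_of_thin (H : SimpleGraph V) [DecidableRel H.Adj] (w : Sym2 V → unitInterval) {a b c : V}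
    (hH : ∀ u v, u ≠ v → (0 : ℝ) < w s(u, v) → H.Adj u v) (B : Set V) (htB : a ∈ B ∨ b ∈ B ∨ c ∈ B)
    (hB : ∀ u v, u ∈ B → H.Adj u v → v ≠ a → v ≠ b → v ≠ c → v ∈ B)
    (hdeg : ∀ v ∈ B, v ≠ a → v ≠ b → v ≠ c → H.degree v ≤ 2) {ω η : Set (Sym2 V)}
    (hω : ∀ e ∈ ω, (0 : ℝ) < w e) (hη : ∀ e ∈ η, (0 : ℝ) < w e)
    (hab : ¬ (openGraph ω).Reachable a b) (hac : ¬ (openGraph ω).Reachable a c) (hbc : ¬ (openGraph ω).Reachable b c)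
    (hbc' : ¬ (openGraph (η \ barOf {a} (setCl ω {a}))).Reachable b c) :
    ¬ ((∃ y k : V, (openGraph ω).Reachable a k ∧ (0 : ℝ) < w s(k, y) ∧ (openGraph ω).Reachable b y ∧
          (openGraph (η \ barOf {a} (setCl ω {a}))).Reachable c y) ∧
       (∃ y k : V, (openGraph ω).Reachable a k ∧ (0 : ℝ) < w s(k, y) ∧ (openGraph ω).Reachable c y ∧
          (openGraph (η \ barOf {a} (setCl ω {a}))).Reachable b y)) := by
  rintro ⟨⟨y, k, hk, hw, hby, hcy⟩, ⟨y', k', hk', hw', hcy', hby'⟩⟩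
  have hadjH : ∀ (ξ : Set (Sym2 V)), (∀ e ∈ ξ, (0 : ℝ) < w e) → ∀ u v, (openGraph ξ).Adj u v → H.Adj u v := by
    intro ξ hξ u v huv
    rw [openGraph_adj] at huv
    exact hH u v huv.2 (hξ _ huv.1)
  have hθ : ∀ e ∈ η \ barOf {a} (setCl ω {a}), (0 : ℝ) < w e := fun e he => hη e he.1
  have hθK : ∀ u v, (openGraph (η \ barOf {a} (setCl ω {a}))).Adj u v → ¬ (openGraph ω).Reachable a v := by
    intro u v huv hav
    rw [openGraph_adj, barOf_setCl_singleton_eq_cutSet] at huv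
    exact huv.1.2 ⟨v, Sym2.mem_mk_right u v, hav⟩
  have hky : H.Adj k y := hH k y (fun h => hab (hk.trans (h ▸ hby.symm))) hw
  rcases htB with haB | hbB | hcB
  · -- `a` thin: `K ⊆ B`, hence `y ∈ B`
    obtain ⟨W⟩ := id hk
    have hkB : k ∈ B := by
      refine mem_of_openWalk H B hB (hadjH ω hω) W haB fun x hx => ?_
      have hax : (openGraph ω).Reachable a x := ⟨W.takeUntil x hx⟩
      by_cases hxa : x = a
      · exact Or.inl (hxa ▸ haB)
      · exact Or.inr ⟨hxa, fun h => hab (h ▸ hax), fun h => hac (h ▸ hax)⟩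
    have hyB : y ∈ B := hB k y hkB hky (fun h => hab (by rw [← h]; exact hby.symm))
      (fun h => hbc' (by rw [← h]; exact hcy.symm)) fun h => hbc (by rw [← h]; exact hby)
    exact not_clash_of_thin H B (Or.inr hyB) hB hdeg (hadjH ω hω) (hadjH _ hθ) hθK hab hbc hbc' hk hky hby hcy
  · exact not_clash_of_thin H B (Or.inl hbB) hB hdeg (hadjH ω hω) (hadjH _ hθ) hθK hab hbc hbc' hk hky hby hcy
  · have hky' : H.Adj k' y' := hH k' y' (fun h => hac (hk'.trans (h ▸ hcy'.symm))) hw'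
    exact not_clash_of_thin H B (Or.inl hcB) (fun u v hu huv hva hvc hvb => hB u v hu huv hva hvb hvc)
      (fun v hv hva hvc hvb => hdeg v hv hva hvb hvc) (hadjH ω hω) (hadjH _ hθ) hθK hac
      (fun h => hbc h.symm) (fun h => hbc' h.symm) hk' hky' hcy' hby'

end General

/-! ### `Fin n` forms -/

/-- **CSQ at `(a; b, c)` when `a`, `b` or `c` is thinly attached**: `H` a graph on `Fin n` carrying all pairs of positive weight,
`B` a set of vertices containing one of `a, b, c` and closed under `H`-steps into vertices outside `{a, b, c}`, all of whose vertices
outside `{a, b, c}` have `H`-degree ≤ 2.  Then `clusterSquare w a b c ≤ μ(b ↮ c)²`.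
[cite: Gladkov2024, Thm. 4.3, Def. 4.2, Lemma 3.1, Example 2.5] -/
theorem clusterSquare_le_sq_of_thin {n : ℕ} (w : Sym2 (Fin n) → unitInterval) (a b c : Fin n)
    (H : SimpleGraph (Fin n)) [DecidableRel H.Adj] (hH : ∀ u v, u ≠ v → (0 : ℝ) < w s(u, v) → H.Adj u v)
    (B : Set (Fin n)) (htB : a ∈ B ∨ b ∈ B ∨ c ∈ B) (hB : ∀ u v, u ∈ B → H.Adj u v → v ≠ a → v ≠ b → v ≠ c → v ∈ B)
    (hdeg : ∀ v ∈ B, v ≠ a → v ≠ b → v ≠ c → H.degree v ≤ 2) :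
    clusterSquare w a b c ≤ (prodBernoulli w).real (openConn b c)ᶜ ^ 2 :=
  clusterSquare_le_sq_of_noDoubleClash_pos w a b c fun _ _ hω hη hab hac hbc hbc' =>
    not_doubleClash_of_thin H w hH B htB hB hdeg hω hη hab hac hbc hbc'

/-- **DUU at `(a; b, c)` when `a`, `b` or `c` is thinly attached.** [cite: Gladkov2024, Thm. 5.2 and Thm. 4.3] -/
theorem sq_real_split_le_of_thin {n : ℕ} (w : Sym2 (Fin n) → unitInterval) (a b c : Fin n)
    (H : SimpleGraph (Fin n)) [DecidableRel H.Adj] (hH : ∀ u v, u ≠ v → (0 : ℝ) < w s(u, v) → H.Adj u v)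
    (B : Set (Fin n)) (htB : a ∈ B ∨ b ∈ B ∨ c ∈ B) (hB : ∀ u v, u ∈ B → H.Adj u v → v ≠ a → v ≠ b → v ≠ c → v ∈ B)
    (hdeg : ∀ v ∈ B, v ≠ a → v ≠ b → v ≠ c → H.degree v ≤ 2) :
    (prodBernoulli w).real ((openConn a b)ᶜ ∩ (openConn a c)ᶜ ∩ (openConn b c)ᶜ) ^ 2 ≤
      (prodBernoulli w).real ((openConn a b)ᶜ ∩ (openConn a c)ᶜ) * (prodBernoulli w).real (openConn b c)ᶜ ^ 2 :=
  sq_real_split_le_of_noDoubleClash_pos w a b c fun _ _ hω hη hab hac hbc hbc' =>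
    not_doubleClash_of_thin H w hH B htB hB hdeg hω hη hab hac hbc hbc'

/-- **TS for `{a, b, c}` when one of the terminals is thinly attached**: `μ(a ↮ b, a ↮ c, b ↮ c)² ≤ μ(a ↮ b) μ(a ↮ c) μ(b ↮ c)`
(`B` containing one of `a, b, c`, closed under `H`-steps into vertices outside `{a, b, c}`, all of whose vertices outside `{a, b, c}`
have `H`-degree ≤ 2, `H` carrying all pairs of positive weight).
[cite: Gladkov2024, Thm. 5.2, Cor. 5.3 (pattern) and Thm. 4.3] -/
theorem tripleSplit_of_thin {n : ℕ} (w : Sym2 (Fin n) → unitInterval) (a b c : Fin n)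
    (H : SimpleGraph (Fin n)) [DecidableRel H.Adj] (hH : ∀ u v, u ≠ v → (0 : ℝ) < w s(u, v) → H.Adj u v)
    (B : Set (Fin n)) (htB : a ∈ B ∨ b ∈ B ∨ c ∈ B) (hB : ∀ u v, u ∈ B → H.Adj u v → v ≠ a → v ≠ b → v ≠ c → v ∈ B)
    (hdeg : ∀ v ∈ B, v ≠ a → v ≠ b → v ≠ c → H.degree v ≤ 2) :
    (prodBernoulli w).real ((openConn a b)ᶜ ∩ (openConn a c)ᶜ ∩ (openConn b c)ᶜ) ^ 2 ≤
      (prodBernoulli w).real (openConn a b)ᶜ * (prodBernoulli w).real (openConn a c)ᶜ *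
        (prodBernoulli w).real (openConn b c)ᶜ :=
  tripleSplit_of_noDoubleClash_pos w a b c fun _ _ hω hη hab hac hbc hbc' =>
    not_doubleClash_of_thin H w hH B htB hB hdeg hω hη hab hac hbc hbc'

/-- **TS for `{a, b, c}` when only the terminals branch**: if every vertex outside `{a, b, c}` has at most two neighbours in a graph
`H` carrying all pairs of positive weight (three terminals joined by internally disjoint paths in any number and pattern, pendant paths
allowed), then `μ(a ↮ b, a ↮ c, b ↮ c)² ≤ μ(a ↮ b) μ(a ↮ c) μ(b ↮ c)`. [cite: Gladkov2024, Thm. 5.2, Cor. 5.3 (pattern) and Thm. 4.3] -/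
theorem tripleSplit_of_degree_le_two {n : ℕ} (w : Sym2 (Fin n) → unitInterval) (a b c : Fin n)
    (H : SimpleGraph (Fin n)) [DecidableRel H.Adj] (hH : ∀ u v, u ≠ v → (0 : ℝ) < w s(u, v) → H.Adj u v)
    (hdeg : ∀ v, v ≠ a → v ≠ b → v ≠ c → H.degree v ≤ 2) :
    (prodBernoulli w).real ((openConn a b)ᶜ ∩ (openConn a c)ᶜ ∩ (openConn b c)ᶜ) ^ 2 ≤
      (prodBernoulli w).real (openConn a b)ᶜ * (prodBernoulli w).real (openConn a c)ᶜ *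
        (prodBernoulli w).real (openConn b c)ᶜ :=
  tripleSplit_of_thin w a b c H hH Set.univ (Or.inl (Set.mem_univ a)) (fun _ _ _ _ _ _ _ => Set.mem_univ _)
    fun v _ => hdeg v

/-- **CSQ at `(a; b, c)` when only the terminals branch.** [cite: Gladkov2024, Thm. 4.3, Def. 4.2, Lemma 3.1, Example 2.5] -/
theorem clusterSquare_le_sq_of_degree_le_two {n : ℕ} (w : Sym2 (Fin n) → unitInterval) (a b c : Fin n)
    (H : SimpleGraph (Fin n)) [DecidableRel H.Adj] (hH : ∀ u v, u ≠ v → (0 : ℝ) < w s(u, v) → H.Adj u v)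
    (hdeg : ∀ v, v ≠ a → v ≠ b → v ≠ c → H.degree v ≤ 2) :
    clusterSquare w a b c ≤ (prodBernoulli w).real (openConn b c)ᶜ ^ 2 :=
  clusterSquare_le_sq_of_thin w a b c H hH Set.univ (Or.inl (Set.mem_univ a)) (fun _ _ _ _ _ _ _ => Set.mem_univ _)
    fun v _ => hdeg v

end Consts

end Summit.CriticalPhenomena.PercolationContinuityZ3.Theorems
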